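import Mathlib
import HarnessLib
import Literature.Probability.MarkovChains.MetropolisHastings
import Literature.Probability.MarkovChains.TotalVariation
import Summits.Ventures.LatticeQCDFlow.Exactness.JarzynskiFinite
import Summits.Ventures.LatticeQCDFlow.Exactness.TemperedTransitions
import Summits.Ventures.LatticeQCDFlow.Exactness.CrooksReversal

/-!
# Bennett's acceptance ratio: the population equation, the unique root of the sample equation, and the dissipation form of the ESS

HONEST FRAMING: exact (Metropolis-corrected) sampling algorithms for lattice gauge theory;
figures of merit are autocorrelation/cost numbers at stated couplings and volumes; no
continuum-physics claim.

Venture `LatticeQCDFlow` (cell pub-lqcd), topic `Exactness`; FANOUT row 13 (`eng-snf`: the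
`latflow-snf` protocol engine — `snf.estimators.bar` (bisection on the sample equation below),
`snf.estimators.ess_kish`, `snf.protocol.run_forward / run_reverse`; tests t14, t18).  NEW WORK
of the cell (elementary finite sums and one-variable real analysis); the printed counterparts
are named only, nothing is cited as a fact: C. H. Bennett, J. Comput. Phys. 22 (1976) 245;
M. R. Shirts, E. Bair, G. Hooker, V. S. Pande, Phys. Rev. Lett. 91 (2003) 140601 (the
self-consistent / maximum-likelihood form of the acceptance-ratio equation).

## Content

Setting of `CrooksReversal.lean`: a forward protocol `S 0, …, S n` with kernels `P k` and the
reverse protocol with the adjoint kernels `Padj k` (`MutuallyReversible (e^{-S (k+1)}) (P k)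
(Padj k)`), reverse paths indexed by forward time so that the reverse work is `-work S x`; write
`ΔF = F n - F 0 = -log (Z n / Z 0)` (`freeEnergy`) and `fermiWeight t = 1 / (1 + e^t)`.

* `bennett_population` — for EVERY real shift `M`:
  `e^M · E_fwd[fermiWeight (M + W - ΔF)] = E_rev[fermiWeight (-M + W_rev + ΔF)]`
  (with `W_rev = -work S x`).  This is `crooks_work_observable` with
  `φ(w) = e^w · fermiWeight (M + w - ΔF)` and the algebraic identity `e^t · fermiWeight t = fermiWeight (-t)`.
  With `M = log (n_f / n_r)` it is the equation `n_f E_f[f(M + W - ΔF)] = n_r E_r[f(-M + W_r + ΔF)]`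
  whose empirical version Bennett's estimator solves: the true `ΔF` is a root IN POPULATION for any
  protocol, any `n`, any adjoint pair of kernels (exactness); the choice of `M` only affects variance.
* `barFn M Wf Wr d = Σ_i fermiWeight (M + Wf i - d) - Σ_j fermiWeight (-M + Wr j + d)` — the SAMPLE
  equation's left side for forward works `Wf : ι → ℝ` and reverse works `Wr : κ → ℝ`;
  `barFn_strictMono` (one forward sample suffices), `continuous_barFn`,
  `barFn_tendsto_atBot / atTop` (limits `-|κ|` and `|ι|`), and `barFn_existsUnique_root`: with at
  least one forward and one reverse work value the sample equation has EXACTLY ONE root — the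
  number `snf.estimators.bar` returns (its bisection bracket is justified by the two limits).
* `essPop_eq_inv_dissipation` — the population Kish effective sample size of the Jarzynski
  weights, `(E_f[e^{-W}])² / E_f[e^{-2W}]`, equals `1 / E_f[e^{-2(W - ΔF)}]` (row 13's
  "ESS = 1/⟨e^{-2 W_d}⟩" diagnostic): a consequence of `jarzynski` (`E_f[e^{-W}] = e^{-ΔF}`).
* `exp_neg_two_dissipation_eq_reverse` / `essPop_le_exp_neg_reverse_dissipation` (appended) —
  `E_f[e^{-2 W_d}] = E_r[e^{+W_d^rev}]` (Crooks) and hence, by Jensen,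
  `ESS_fwd ≤ exp(-E_rev[W_d^rev])`: each lane's asymptotic efficiency is bounded by the OTHER
  lane's mean dissipated work (a two-sided run certifies the bound without any free-energy estimate).
-/

namespace Summit.Ventures.LatticeQCDFlow.Exactness

open Finset Filter Topology
open Literature.Probability.MarkovChains

/-! ## The Fermi function -/

/-- The Fermi function `fermiWeight t = 1 / (1 + e^t)` (Bennett's optimal weighting function). -/
noncomputable def fermiWeight (t : ℝ) : ℝ := 1 / (1 + Real.exp t)

/-- `0 < fermiWeight t`. -/
theorem fermiWeight_pos (t : ℝ) : 0 < fermiWeight t := by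
  unfold fermiWeight
  exact div_pos one_pos (by positivity)

/-- `fermiWeight t < 1`. -/
theorem fermiWeight_lt_one (t : ℝ) : fermiWeight t < 1 := by
  unfold fermiWeight
  rw [div_lt_one (by positivity : (0:ℝ) < 1 + Real.exp t)]
  linarith [Real.exp_pos t]

/-- `e^t · fermiWeight t = fermiWeight (-t)` : `e^t / (1 + e^t) = 1 / (1 + e^{-t})`. -/
theorem exp_mul_fermiWeight (t : ℝ) : Real.exp t * fermiWeight t = fermiWeight (-t) := by
  unfold fermiWeight
  have h1 : (1 + Real.exp t) ≠ 0 := (by positivity : (0:ℝ) < 1 + Real.exp t).ne'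
  have h2 : (1 + Real.exp (-t)) ≠ 0 := (by positivity : (0:ℝ) < 1 + Real.exp (-t)).ne'
  have hmul : Real.exp t * Real.exp (-t) = 1 := by rw [← Real.exp_add, add_neg_cancel, Real.exp_zero]
  field_simp
  linarith [hmul]

/-- `fermiWeight t + fermiWeight (-t) = 1`. -/
theorem fermiWeight_add_fermiWeight_neg (t : ℝ) : fermiWeight t + fermiWeight (-t) = 1 := by
  rw [← exp_mul_fermiWeight]
  unfold fermiWeight
  have h1 : (1 + Real.exp t) ≠ 0 := (by positivity : (0:ℝ) < 1 + Real.exp t).ne'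
  field_simp

/-- `fermiWeight` is continuous. -/
theorem continuous_fermiWeight : Continuous fermiWeight := by
  unfold fermiWeight
  exact continuous_const.div (continuous_const.add Real.continuous_exp) fun t => (by positivity : (0:ℝ) < 1 + Real.exp t).ne'

/-- `fermiWeight` is strictly decreasing. -/
theorem fermiWeight_strictAnti : StrictAnti fermiWeight := by
  intro a b hab
  unfold fermiWeight
  apply one_div_lt_one_div_of_lt (by positivity : (0:ℝ) < 1 + Real.exp a)
  linarith [Real.exp_lt_exp.mpr hab]

/-- `fermiWeight t → 0` as `t → +∞`. -/
theorem fermiWeight_tendsto_atTop : Tendsto fermiWeight atTop (𝓝 0) := by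
  have h : Tendsto (fun t => 1 + Real.exp t) atTop atTop :=
    tendsto_atTop_add_const_left _ _ Real.tendsto_exp_atTop
  have h' : Tendsto (fun t => (1 + Real.exp t)⁻¹) atTop (𝓝 0) := h.inv_tendsto_atTop
  refine h'.congr fun t => ?_
  simp [fermiWeight, one_div]

/-- `fermiWeight t → 1` as `t → -∞`. -/
theorem fermiWeight_tendsto_atBot : Tendsto fermiWeight atBot (𝓝 1) := by
  have h : Tendsto (fun t => 1 + Real.exp t) atBot (𝓝 (1 + 0)) :=
    tendsto_const_nhds.add Real.tendsto_exp_atBot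
  have h' : Tendsto (fun t => (1 + Real.exp t)⁻¹) atBot (𝓝 ((1 + 0)⁻¹)) := h.inv₀ (by norm_num)
  rw [add_zero, inv_one] at h'
  refine h'.congr fun t => ?_
  simp [fermiWeight, one_div]

/-! ## Bennett's equation holds in population (a corollary of Crooks) -/

variable {X : Type*} [Fintype X]

/-- `Z n / Z 0 = e^{-(F n - F 0)}`. -/
theorem partitionFn_div_eq_exp_neg_freeEnergy_sub [Nonempty X] (S₀ S₁ : X → ℝ) :
    partitionFn S₁ / partitionFn S₀ = Real.exp (-(freeEnergy S₁ - freeEnergy S₀)) := by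
  have hZ0 : 0 < partitionFn S₀ := sum_pos (fun y _ => Real.exp_pos _) univ_nonempty
  have hZ1 : 0 < partitionFn S₁ := sum_pos (fun y _ => Real.exp_pos _) univ_nonempty
  unfold freeEnergy
  rw [show -(-Real.log (partitionFn S₁) - -Real.log (partitionFn S₀)) =
      Real.log (partitionFn S₁) - Real.log (partitionFn S₀) by ring,
    Real.exp_sub, Real.exp_log hZ1, Real.exp_log hZ0]

/-- **Bennett's acceptance-ratio equation holds in population.**  For every shift `M`,
`e^M · Σ_x pathLaw_fwd x · fermiWeight (M + W(x) - ΔF) = Σ_x revLaw x · fermiWeight (-M + W_rev(x) + ΔF)`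
with `W_rev(x) = -work S x`, `ΔF = freeEnergy (S n) - freeEnergy (S 0)` and the reverse path weight
`gibbsLaw (S n) (x n) · downProb Padj x` of `CrooksReversal.lean`.  With `M = log (n_f / n_r)` this is
the self-consistent equation of Bennett (1976) / Shirts et al. (2003): the exact `ΔF` solves it in
expectation for ANY protocol length and ANY adjoint pair of kernels — the estimator's exactness
rests on Crooks' identity alone; `M` and the protocol quality only change the variance. -/
theorem bennett_population {n : ℕ} [Nonempty X] (S : Fin (n + 1) → X → ℝ) (P Padj : Fin n → X → X → ℝ)
    (hrev : ∀ k : Fin n, MutuallyReversible (fun a => Real.exp (-S k.succ a)) (P k) (Padj k))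
    (M : ℝ) :
    Real.exp M * ∑ x : Fin (n + 1) → X, pathLaw (gibbsLaw (S 0)) P x *
        fermiWeight (M + work S x - (freeEnergy (S (Fin.last n)) - freeEnergy (S 0))) =
      ∑ x : Fin (n + 1) → X, gibbsLaw (S (Fin.last n)) (x (Fin.last n)) * downProb Padj x *
        fermiWeight (-M - work S x + (freeEnergy (S (Fin.last n)) - freeEnergy (S 0))) := by
  set ΔF := freeEnergy (S (Fin.last n)) - freeEnergy (S 0) with hΔF
  -- Crooks with φ(w) = e^w · fermiWeight (M + w - ΔF)
  have h := crooks_work_observable S P Padj hrev fun w => Real.exp w * fermiWeight (M + w - ΔF)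
  have hl : ∀ x : Fin (n + 1) → X, pathLaw (gibbsLaw (S 0)) P x * Real.exp (-work S x) *
      (Real.exp (work S x) * fermiWeight (M + work S x - ΔF)) =
      pathLaw (gibbsLaw (S 0)) P x * fermiWeight (M + work S x - ΔF) := by
    intro x
    have : Real.exp (-work S x) * Real.exp (work S x) = 1 := by
      rw [← Real.exp_add, neg_add_cancel, Real.exp_zero]
    calc pathLaw (gibbsLaw (S 0)) P x * Real.exp (-work S x) * (Real.exp (work S x) * fermiWeight (M + work S x - ΔF))
        = pathLaw (gibbsLaw (S 0)) P x * (Real.exp (-work S x) * Real.exp (work S x)) * fermiWeight (M + work S x - ΔF) := by ring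
      _ = pathLaw (gibbsLaw (S 0)) P x * fermiWeight (M + work S x - ΔF) := by rw [this, mul_one]
  simp only [hl] at h
  rw [partitionFn_div_eq_exp_neg_freeEnergy_sub, ← hΔF] at h
  -- pointwise on the reverse side: e^{-ΔF} · e^{W} · fermiWeight (M + W - ΔF) = e^{-M} · fermiWeight (-M - W + ΔF)
  have hr : ∀ x : Fin (n + 1) → X, Real.exp (-ΔF) * (gibbsLaw (S (Fin.last n)) (x (Fin.last n)) * downProb Padj x *
      (Real.exp (work S x) * fermiWeight (M + work S x - ΔF))) =
      Real.exp (-M) * (gibbsLaw (S (Fin.last n)) (x (Fin.last n)) * downProb Padj x * fermiWeight (-M - work S x + ΔF)) := by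
    intro x
    have key : Real.exp (-ΔF) * (Real.exp (work S x) * fermiWeight (M + work S x - ΔF)) =
        Real.exp (-M) * fermiWeight (-M - work S x + ΔF) := by
      have e1 : Real.exp (-ΔF) * Real.exp (work S x) = Real.exp (-M) * Real.exp (M + work S x - ΔF) := by
        rw [← Real.exp_add, ← Real.exp_add]; ring_nf
      calc Real.exp (-ΔF) * (Real.exp (work S x) * fermiWeight (M + work S x - ΔF))
          = (Real.exp (-ΔF) * Real.exp (work S x)) * fermiWeight (M + work S x - ΔF) := by ring
        _ = Real.exp (-M) * (Real.exp (M + work S x - ΔF) * fermiWeight (M + work S x - ΔF)) := by rw [e1]; ring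
        _ = Real.exp (-M) * fermiWeight (-(M + work S x - ΔF)) := by rw [exp_mul_fermiWeight]
        _ = Real.exp (-M) * fermiWeight (-M - work S x + ΔF) := by ring_nf
    calc Real.exp (-ΔF) * (gibbsLaw (S (Fin.last n)) (x (Fin.last n)) * downProb Padj x *
          (Real.exp (work S x) * fermiWeight (M + work S x - ΔF)))
        = gibbsLaw (S (Fin.last n)) (x (Fin.last n)) * downProb Padj x *
          (Real.exp (-ΔF) * (Real.exp (work S x) * fermiWeight (M + work S x - ΔF))) := by ring
      _ = gibbsLaw (S (Fin.last n)) (x (Fin.last n)) * downProb Padj x *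
          (Real.exp (-M) * fermiWeight (-M - work S x + ΔF)) := by rw [key]
      _ = Real.exp (-M) * (gibbsLaw (S (Fin.last n)) (x (Fin.last n)) * downProb Padj x * fermiWeight (-M - work S x + ΔF)) := by ring
  rw [mul_sum] at h
  simp only [hr] at h
  rw [← mul_sum] at h
  -- h : Σ_f = e^{-M} · Σ_r ; multiply by e^{M}
  rw [h, ← mul_assoc, ← Real.exp_add, add_neg_cancel, Real.exp_zero, one_mul]

/-! ## The sample equation has exactly one root -/

section Sample

variable {ι κ : Type*} [Fintype ι] [Fintype κ]

/-- The BAR sample function: `Σ_i fermiWeight (M + Wf i - d) - Σ_j fermiWeight (-M + Wr j + d)` for forward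
works `Wf` and reverse works `Wr`; `snf.estimators.bar` returns its root in `d` (with
`M = log (n_f / n_r)`). -/
noncomputable def barFn (M : ℝ) (Wf : ι → ℝ) (Wr : κ → ℝ) (d : ℝ) : ℝ :=
  ∑ i, fermiWeight (M + Wf i - d) - ∑ j, fermiWeight (-M + Wr j + d)

/-- The BAR sample function is continuous in `d`. -/
theorem continuous_barFn (M : ℝ) (Wf : ι → ℝ) (Wr : κ → ℝ) : Continuous (barFn M Wf Wr) := by
  unfold barFn
  refine Continuous.sub ?_ ?_
  · exact continuous_finsetSum _ fun i _ => continuous_fermiWeight.comp (by continuity)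
  · exact continuous_finsetSum _ fun j _ => continuous_fermiWeight.comp (by continuity)

/-- Each forward term increases and each reverse term decreases in `d`; with at least one forward
work value the sample function is strictly increasing. -/
theorem barFn_strictMono [Nonempty ι] (M : ℝ) (Wf : ι → ℝ) (Wr : κ → ℝ) :
    StrictMono (barFn M Wf Wr) := by
  intro a b hab
  unfold barFn
  have hf : ∑ i, fermiWeight (M + Wf i - a) < ∑ i, fermiWeight (M + Wf i - b) :=
    sum_lt_sum_of_nonempty univ_nonempty fun i _ => fermiWeight_strictAnti (by linarith)
  have hr : ∑ j, fermiWeight (-M + Wr j + b) ≤ ∑ j, fermiWeight (-M + Wr j + a) :=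
    sum_le_sum fun j _ => (fermiWeight_strictAnti.antitone (by linarith))
  linarith

/-- `barFn → -|κ|` as `d → -∞`. -/
theorem barFn_tendsto_atBot (M : ℝ) (Wf : ι → ℝ) (Wr : κ → ℝ) :
    Tendsto (barFn M Wf Wr) atBot (𝓝 (0 - (Fintype.card κ : ℝ))) := by
  unfold barFn
  refine Tendsto.sub ?_ ?_
  · have : Tendsto (fun d => ∑ i, fermiWeight (M + Wf i - d)) atBot (𝓝 (∑ _i : ι, (0 : ℝ))) := by
      refine tendsto_finsetSum _ fun i _ => ?_
      refine fermiWeight_tendsto_atTop.comp ?_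
      exact tendsto_atBot_atTop_of_antitone (fun a b h => by linarith) (fun b => ⟨M + Wf i - b, by linarith⟩)
    simpa using this
  · have : Tendsto (fun d => ∑ j, fermiWeight (-M + Wr j + d)) atBot (𝓝 (∑ _j : κ, (1 : ℝ))) := by
      refine tendsto_finsetSum _ fun j _ => ?_
      refine fermiWeight_tendsto_atBot.comp ?_
      exact tendsto_atBot_atBot_of_monotone (fun a b h => by linarith) (fun b => ⟨b + M - Wr j, by linarith⟩)
    simpa using this

/-- `barFn → |ι|` as `d → +∞`. -/
theorem barFn_tendsto_atTop (M : ℝ) (Wf : ι → ℝ) (Wr : κ → ℝ) :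
    Tendsto (barFn M Wf Wr) atTop (𝓝 ((Fintype.card ι : ℝ) - 0)) := by
  unfold barFn
  refine Tendsto.sub ?_ ?_
  · have : Tendsto (fun d => ∑ i, fermiWeight (M + Wf i - d)) atTop (𝓝 (∑ _i : ι, (1 : ℝ))) := by
      refine tendsto_finsetSum _ fun i _ => ?_
      refine fermiWeight_tendsto_atBot.comp ?_
      exact tendsto_atTop_atBot_of_antitone (fun a b h => by linarith) (fun b => ⟨M + Wf i - b, by linarith⟩)
    simpa using this
  · have : Tendsto (fun d => ∑ j, fermiWeight (-M + Wr j + d)) atTop (𝓝 (∑ _j : κ, (0 : ℝ))) := by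
      refine tendsto_finsetSum _ fun j _ => ?_
      refine fermiWeight_tendsto_atTop.comp ?_
      exact tendsto_atTop_atTop_of_monotone (fun a b h => by linarith) (fun b => ⟨b + M - Wr j, by linarith⟩)
    simpa using this

/-- **The BAR sample equation has exactly one root.**  Given at least one forward and one reverse
work value, `d ↦ barFn M Wf Wr d` is continuous, strictly increasing, tends to `-|κ| < 0` at `-∞`
and to `|ι| > 0` at `+∞`; hence there is exactly one `d` with `barFn M Wf Wr d = 0` — the Bennett
estimate.  (Bisection on any bracket `[lo, hi]` with `barFn lo < 0 < barFn hi` converges to it.) -/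
theorem barFn_existsUnique_root [Nonempty ι] [Nonempty κ] (M : ℝ) (Wf : ι → ℝ) (Wr : κ → ℝ) :
    ∃! d, barFn M Wf Wr d = 0 := by
  have hmono := barFn_strictMono M Wf Wr
  have hκ : (0 : ℝ) - (Fintype.card κ : ℝ) < 0 := by
    have : (0 : ℝ) < Fintype.card κ := by exact_mod_cast Fintype.card_pos
    linarith
  have hι : (0 : ℝ) < (Fintype.card ι : ℝ) - 0 := by
    have : (0 : ℝ) < Fintype.card ι := by exact_mod_cast Fintype.card_pos
    linarith
  obtain ⟨a, ha⟩ := ((barFn_tendsto_atBot M Wf Wr).eventually (gt_mem_nhds hκ)).exists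
  obtain ⟨b, hb⟩ := ((barFn_tendsto_atTop M Wf Wr).eventually (lt_mem_nhds hι)).exists
  have hab : a ≤ b := by
    by_contra h
    have := hmono (lt_of_not_ge h)
    linarith
  obtain ⟨d, _, hd⟩ := intermediate_value_Icc hab (continuous_barFn M Wf Wr).continuousOn
    ⟨ha.le, hb.le⟩
  exact ⟨d, hd, fun d' hd' => hmono.injective (hd'.trans hd.symm)⟩

end Sample

/-! ## The dissipation form of the population ESS -/

/-- **Population Kish ESS of the Jarzynski weights = `1 / E_f[e^{-2 W_d}]`.**  With `w = e^{-W}` and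
`W_d = W - ΔF` the dissipated work, `(E_f[w])² / E_f[w²] = 1 / E_f[e^{-2 W_d}]`, because
`E_f[w] = e^{-ΔF}` (Jarzynski).  This is the diagnostic `snf.estimators` reports next to ΔF̂: a
protocol's asymptotic effective-sample-size FRACTION is the inverse second exponential moment of
its dissipated work (1 for a quasi-static or perfectly transporting protocol, small when `W_d`
fluctuates). -/
theorem essPop_eq_inv_dissipation {n : ℕ} [Nonempty X] (S : Fin (n + 1) → X → ℝ)
    (P : Fin n → X → X → ℝ)
    (hP : ∀ k : Fin n, IsStationary (fun x => Real.exp (-S k.succ x)) (P k)) :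
    (∑ x : Fin (n + 1) → X, pathLaw (gibbsLaw (S 0)) P x * Real.exp (-work S x)) ^ 2 /
        (∑ x : Fin (n + 1) → X, pathLaw (gibbsLaw (S 0)) P x * Real.exp (-(2 * work S x))) =
      1 / ∑ x : Fin (n + 1) → X, pathLaw (gibbsLaw (S 0)) P x *
        Real.exp (-(2 * (work S x - (freeEnergy (S (Fin.last n)) - freeEnergy (S 0))))) := by
  set ΔF := freeEnergy (S (Fin.last n)) - freeEnergy (S 0) with hΔF
  have hJ : ∑ x : Fin (n + 1) → X, pathLaw (gibbsLaw (S 0)) P x * Real.exp (-work S x) = Real.exp (-ΔF) := by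
    rw [jarzynski S P hP, partitionFn_div_eq_exp_neg_freeEnergy_sub]
  have hsplit : ∀ x : Fin (n + 1) → X, pathLaw (gibbsLaw (S 0)) P x * Real.exp (-(2 * (work S x - ΔF))) =
      Real.exp (2 * ΔF) * (pathLaw (gibbsLaw (S 0)) P x * Real.exp (-(2 * work S x))) := by
    intro x
    have : Real.exp (-(2 * (work S x - ΔF))) = Real.exp (2 * ΔF) * Real.exp (-(2 * work S x)) := by
      rw [← Real.exp_add]; ring_nf
    rw [this]; ring
  simp only [hsplit]
  rw [← mul_sum, hJ]
  have hsq : Real.exp (-ΔF) ^ 2 = Real.exp (-(2 * ΔF)) := by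
    rw [sq, ← Real.exp_add]; ring_nf
  rw [hsq]
  have hpos : 0 < Real.exp (2 * ΔF) := Real.exp_pos _
  have hinv : Real.exp (-(2 * ΔF)) = 1 / Real.exp (2 * ΔF) := by
    rw [Real.exp_neg, one_div]
  rw [hinv]
  field_simp

/-! ## The forward ESS is bounded by the reverse dissipation (appended 2026-08-21, same seat) -/

/-- **Second exponential moment of the dissipated work = first exponential moment on the reverse
side.**  With `W_d = W - ΔF` (forward dissipated work) and the reverse process of
`CrooksReversal.lean` (whose own dissipated work along the forward-indexed path `x` is
`-(W(x) - ΔF)`): `E_fwd[e^{-2 W_d}] = E_rev[e^{+W_d^rev}] = Σ_x revLaw x · e^{-(W(x) - ΔF)}` —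
Crooks' identity with `F = e^{-W + 2ΔF}`.  The left side is the inverse population ESS
(`essPop_eq_inv_dissipation`). -/
theorem exp_neg_two_dissipation_eq_reverse {n : ℕ} [Nonempty X] (S : Fin (n + 1) → X → ℝ)
    (P Padj : Fin n → X → X → ℝ)
    (hrev : ∀ k : Fin n, MutuallyReversible (fun a => Real.exp (-S k.succ a)) (P k) (Padj k)) :
    ∑ x : Fin (n + 1) → X, pathLaw (gibbsLaw (S 0)) P x *
        Real.exp (-(2 * (work S x - (freeEnergy (S (Fin.last n)) - freeEnergy (S 0))))) =
      ∑ x : Fin (n + 1) → X, gibbsLaw (S (Fin.last n)) (x (Fin.last n)) * downProb Padj x *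
        Real.exp (-(work S x - (freeEnergy (S (Fin.last n)) - freeEnergy (S 0)))) := by
  set ΔF := freeEnergy (S (Fin.last n)) - freeEnergy (S 0) with hΔF
  have h := crooks_expectation S P Padj hrev fun x => Real.exp (-work S x + 2 * ΔF)
  rw [partitionFn_div_eq_exp_neg_freeEnergy_sub, ← hΔF] at h
  have hl : ∀ x : Fin (n + 1) → X, pathLaw (gibbsLaw (S 0)) P x * Real.exp (-work S x) *
      Real.exp (-work S x + 2 * ΔF) = pathLaw (gibbsLaw (S 0)) P x * Real.exp (-(2 * (work S x - ΔF))) := by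
    intro x
    rw [mul_assoc, ← Real.exp_add]; ring_nf
  have hr : ∀ x : Fin (n + 1) → X, Real.exp (-ΔF) *
      (gibbsLaw (S (Fin.last n)) (x (Fin.last n)) * downProb Padj x * Real.exp (-work S x + 2 * ΔF)) =
      gibbsLaw (S (Fin.last n)) (x (Fin.last n)) * downProb Padj x * Real.exp (-(work S x - ΔF)) := by
    intro x
    have : Real.exp (-ΔF) * Real.exp (-work S x + 2 * ΔF) = Real.exp (-(work S x - ΔF)) := by
      rw [← Real.exp_add]; ring_nf
    calc Real.exp (-ΔF) * (gibbsLaw (S (Fin.last n)) (x (Fin.last n)) * downProb Padj x * Real.exp (-work S x + 2 * ΔF))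
        = gibbsLaw (S (Fin.last n)) (x (Fin.last n)) * downProb Padj x * (Real.exp (-ΔF) * Real.exp (-work S x + 2 * ΔF)) := by ring
      _ = gibbsLaw (S (Fin.last n)) (x (Fin.last n)) * downProb Padj x * Real.exp (-(work S x - ΔF)) := by rw [this]
  simp only [hl] at h
  rw [mul_sum] at h
  simp only [hr] at h
  exact h

/-- **The forward ESS fraction is at most `e^{-⟨W_d⟩_rev}`.**  If the adjoint kernels are
row-stochastic with non-negative entries (so the reverse path weights form a probability law), then
`ESS_fwd = 1 / E_fwd[e^{-2 W_d}] ≤ exp(-E_rev[W_d^rev])`, where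
`E_rev[W_d^rev] = Σ_x revLaw x · (ΔF - W(x)) ≥ 0` is the MEAN DISSIPATED WORK OF THE REVERSE
PROTOCOL: Jensen (`exp` convex) applied to `exp_neg_two_dissipation_eq_reverse`.  By the symmetric
statement the reverse lane's ESS is bounded by the forward mean dissipation; a two-sided run
(latflow-snf `run_forward` + `run_reverse`) therefore certifies an UPPER bound on each lane's
asymptotic efficiency from the other lane's `⟨W_d⟩` — a cheap, estimator-free diagnostic
(`Records.meta` / `estimators.free_energy(...)['kl']`). -/
theorem essPop_le_exp_neg_reverse_dissipation {n : ℕ} [Nonempty X] (S : Fin (n + 1) → X → ℝ)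
    (P Padj : Fin n → X → X → ℝ)
    (hrev : ∀ k : Fin n, MutuallyReversible (fun a => Real.exp (-S k.succ a)) (P k) (Padj k))
    (hrow : ∀ k b, ∑ a, Padj k b a = 1) (hnn : ∀ k b a, 0 ≤ Padj k b a) :
    1 / ∑ x : Fin (n + 1) → X, pathLaw (gibbsLaw (S 0)) P x *
        Real.exp (-(2 * (work S x - (freeEnergy (S (Fin.last n)) - freeEnergy (S 0))))) ≤
      Real.exp (-(∑ x : Fin (n + 1) → X, gibbsLaw (S (Fin.last n)) (x (Fin.last n)) * downProb Padj x *
        ((freeEnergy (S (Fin.last n)) - freeEnergy (S 0)) - work S x))) := by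
  set ΔF := freeEnergy (S (Fin.last n)) - freeEnergy (S 0) with hΔF
  rw [exp_neg_two_dissipation_eq_reverse S P Padj hrev]
  -- the reverse path weights are a probability law
  set q : (Fin (n + 1) → X) → ℝ := fun x => gibbsLaw (S (Fin.last n)) (x (Fin.last n)) * downProb Padj x with hq
  have hZ : 0 < partitionFn (S (Fin.last n)) := sum_pos (fun y _ => Real.exp_pos _) univ_nonempty
  have hq0 : ∀ x, 0 ≤ q x := fun x =>
    mul_nonneg (div_nonneg (Real.exp_pos _).le hZ.le) (prod_nonneg fun i _ => hnn _ _ _)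
  have hq1 : ∑ x, q x = 1 := sum_reversePathLaw S Padj hrow
  -- Jensen for exp: exp (Σ q·a) ≤ Σ q·exp a
  have hj := convexOn_exp.map_sum_le (t := univ) (w := q) (p := fun x : Fin (n + 1) → X => ΔF - work S x)
    (fun x _ => hq0 x) hq1 (fun x _ => Set.mem_univ _)
  simp only [smul_eq_mul] at hj
  have hsum_pos : 0 < ∑ x, q x * Real.exp (ΔF - work S x) :=
    lt_of_lt_of_le (Real.exp_pos _) hj
  -- rewrite both sides in terms of q and compare
  have hden : ∑ x : Fin (n + 1) → X, gibbsLaw (S (Fin.last n)) (x (Fin.last n)) * downProb Padj x *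
      Real.exp (-(work S x - ΔF)) = ∑ x, q x * Real.exp (ΔF - work S x) := by
    refine sum_congr rfl fun x _ => ?_
    rw [hq, show -(work S x - ΔF) = ΔF - work S x by ring]
  have hnum : ∑ x : Fin (n + 1) → X, gibbsLaw (S (Fin.last n)) (x (Fin.last n)) * downProb Padj x *
      (ΔF - work S x) = ∑ x, q x * (ΔF - work S x) := sum_congr rfl fun x _ => by rw [hq]
  rw [hden, hnum, Real.exp_neg, one_div]
  exact inv_anti₀ (Real.exp_pos _) hj

end Summit.Ventures.LatticeQCDFlow.Exactness
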